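import Literature.Topology.FourManifolds.SeifertDiscUnknotProofs
import Literature.Topology.FourManifolds.SeifertSurfaceOrientation
import Literature.Topology.FourManifolds.SliceGenusDiscMorseProofs
import Literature.Topology.FourManifolds.HCobordismIndexZeroOneProofs
import Literature.Topology.FourManifolds.HCobordismFirstCancellationProofs
import Literature.Topology.FourManifolds.SPC4HandlesCancelStepProofs
import Literature.Topology.FourManifolds.SliceGenusSeifertProofs
import Literature.Topology.FourManifolds.HCobordismTheoremProofs
import Literature.Analysis.Calculus.SardProofs
import HarnessLib

/-!
# `g(K) = 0 ↔ K` is the unknot, from the four leaves still open below it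

Sibling of `SliceGenusUnknotProofs.lean` (fact seat
`provefact-Literature.Topology.FourManifolds.Knot.genus_eq_zero_iff_isUnknot`; named fact
`Literature.Topology.FourManifolds.Knot.genus_eq_zero_iff_isUnknot` of `SliceGenus.lean`: Cromwell,
*Knots and Links* (2004), Ch. 5, p. 103 with Thm. 5.1.1), which proves the fact equivalent to
Seifert's theorem `Knot.exists_hasSeifertSurfaceOfGenus` together with "a knot bounding a disc is
trivial" `Knot.isUnknot_of_hasSeifertSurfaceOfGenus_zero`.  This file pushes the (proved) reductions
of the tree down to the named facts that are still open, with every discharged input fed in, so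
that the discharge `genus_eq_zero_iff_isUnknot_holds` becomes a one-liner once the leaves land.
Everything here is **proved**; no definitions, no named facts.

* `diffeomorph_closedBall_of_genus_zero_of_modelChart` — the disc classification fact of
  `SliceGenusDisc.lean` (Hirsch 1976, Ch. 9 §3, Thm. 3.7, disc case) from the single Morse-theoretic
  leaf still open below it, Milnor's level-and-trajectory preserving chart `ḡ` of the proof of the
  First Cancellation Theorem (`Cobordism.Milnor1965_cancellation_modelChart`, Milnor 1965, proof of
  Thm. 5.4, Assertion 6): by `diffeomorph_closedBall_of_genus_zero_of_facts` (`SliceGenusDiscMorse.lean`)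
  with Thm. 8.1 Index 0 from `Cobordism.Milnor1965_cancel_index_zero_of_facts` (Thm. 4.8 and the local
  structure at index `1` discharged: `Cobordism.Milnor1965_finalRearrangement_holds`,
  `Cobordism.Milnor1965_localStructure_index_one_holds`), the cancellation step from
  `exists_isMorseAdapted_ncard_criticalSetOfIndex_zero_add_one_eq_of_firstCancellation`, Thm. 5.4 on a
  slab from `Cobordism.Milnor1965_firstCancellation_slab_of_modelChart`, and the Morse equality
  `morseEuler_of_isMorseAdapted_holds`.
* Seifert's theorem from its two leaves — the circle-map fact
  `Knot.exists_circleMap_eq_angle_of_hasFraming_zero` and the parity fact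
  `even_finrank_singularHomology_one_of_boundary_circle`, Sard's theorem being discharged
  (`Literature.Analysis.Calculus.sard_holds`) — is `Knot.exists_hasSeifertSurfaceOfGenus_of_facts`
  (`SeifertSurfaceOrientation.lean`), fed inline below; unconditionally it is the theorem
  `Knot.exists_hasSeifertSurfaceOfGenus_holds` (`SliceGenusSeifertProofs.lean`), which this file
  does not restate.
* `Knot.isUnknot_of_hasSeifertSurfaceOfGenus_zero_of_leaves` — Cromwell's "hence" from the chart
  leaf and the disc theorem in `𝕊 3` (`exists_ambientIsotopy_of_smoothDisc_sphereThree`, Hirsch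
  1976, Ch. 8, Thm. 3.1 with `k = 2`, `n = 3`), by `Knot.isUnknot_of_hasSeifertSurfaceOfGenus_zero_of`.
* `Knot.genus_eq_zero_iff_isUnknot_of_leaves` — **the fact from the four open leaves** `hθ`,
  `hpar`, `hE`, `h2`; the discharge `genus_eq_zero_iff_isUnknot_holds` is this theorem applied to
  their four `_holds`, once they exist.
* After the discharge of the disc theorem `h2`
  (`exists_ambientIsotopy_of_smoothDisc_sphereThree_holds`, `SeifertDiscUnknotProofs.lean`, landed
  the same hour): `Knot.isUnknot_of_hasSeifertSurfaceOfGenus_zero_of_modelChart` — "a knot bounding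
  a disc is trivial" now rests on Milnor's chart `ḡ` **alone**;
  `Knot.genus_eq_zero_iff_isUnknot_of_leaves'` — the fact from the **three** remaining leaves `hθ`,
  `hpar`, `hE`; and `isUnknot_of_isIntegralSurgery_zero_of_gabai_of_modelChart` — Property R
  (`isUnknot_of_isIntegralSurgery_zero`, Gabai 1987, Remark 8.5) from Gabai's Corollary 8.3 and
  Milnor's chart, sharpening `isUnknot_of_isIntegralSurgery_zero_of_gabai_of_hirsch`
  (`SeifertDiscUnknot.lean`).

* **After every leaf landed — the discharges.**  With the circle-map fact
  (`Knot.exists_circleMap_eq_angle_of_hasFraming_zero_holds`, `SeifertCircleMapProofs.lean`) and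
  the Betti-number parity (`even_finrank_singularHomology_one_of_boundary_circle_holds`,
  `SurfaceGenusParityProofs.lean`) proved, Seifert's theorem is the theorem
  `Knot.exists_hasSeifertSurfaceOfGenus_holds` (`SliceGenusSeifertProofs.lean`); with the
  deformation of the level diffeomorphism proved
  (`Cobordism.Milnor1965_cancellation_levelDeformation_holds`, `HCobordismLevelDeformationProof.lean`)
  Milnor's chart `ḡ` is the theorem `Cobordism.Milnor1965_cancellation_modelChart_holds`
  (`HCobordismTheoremProofs.lean`).  Fed in, the reductions above discharge three named facts:
  `diffeomorph_closedBall_of_genus_zero_holds` (the classification of the disc,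
  `SliceGenusDisc.lean`), `Knot.isUnknot_of_hasSeifertSurfaceOfGenus_zero_holds` ("a knot
  bounding a disc is trivial", `SeifertGenusZero.lean`) and
  **`Knot.genus_eq_zero_iff_isUnknot_holds`** (`g(K) = 0 ↔ K` is the unknot, `SliceGenus.lean`),
  with the unconditional corollaries `Knot.isUnknot_iff_hasSeifertSurfaceOfGenus_zero`,
  `Knot.genus_eq_zero_iff_isUnknot'`, `Knot.genus_pos_iff_not_isUnknot`, and Property R from
  Gabai's Corollary 8.3 alone (`isUnknot_of_isIntegralSurgery_zero_of_gabai83`).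
## References

* P. R. Cromwell, *Knots and Links*, CUP (2004), Ch. 5, p. 103 (held copy, PDF p. 79) and
  Thm. 5.1.1. [Cromwell2004]
* M. W. Hirsch, *Differential Topology*, GTM 33 (1976), Ch. 8, Thm. 3.1; Ch. 9 §3, Thm. 3.7.
  [HirschDT1976]
* J. Milnor, *Lectures on the h-cobordism theorem* (1965), Thm. 5.4 and its proof, Assertion 6
  (PDF pp. 30–32); Thm. 8.1 Index 0 (PDF p. 54). [MilnorHCobordism1965]
* A. Juhász, *Differential and Low-Dimensional Topology* (2023), Prop. 4.10. [Juhasz2023]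
* D. Gabai, *Foliations and the topology of 3-manifolds. III*, J. Differential Geom. 26 (1987),
  Cor. 8.3, Remark 8.5. [GabaiJDG1987]
* C. D. Papakyriakopoulos, *On Dehn's lemma and the asphericity of knots*, Ann. of Math. 66
  (1957) (the cite carried by the fact). [Papakyriakopoulos1957]
-/

open scoped Manifold ContDiff Topology
open Function Set

noncomputable section

namespace Literature.Topology.FourManifolds

/-! ### The disc classification fact from Milnor's chart `ḡ` alone -/

/-- **The classification of the disc from the one Morse-theoretic leaf still open below it.**
The named fact `diffeomorph_closedBall_of_genus_zero` (`SliceGenusDisc.lean`; Hirsch, *Differential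
Topology* (1976), Ch. 9 §3, Thm. 3.7, `k = 1`, `p = 0`: a compact connected orientable surface with
one boundary circle and `rank H₁ = 0` is a disc) follows from the construction of Milnor's
level-and-trajectory preserving chart `ḡ` in the proof of the First Cancellation Theorem
(`Cobordism.Milnor1965_cancellation_modelChart`; Milnor 1965, proof of Thm. 5.4, Assertion 6): it
gives Thm. 5.4 on a slab (`Cobordism.Milnor1965_firstCancellation_slab_of_modelChart`), hence Thm. 8.1
Index 0 (`Cobordism.Milnor1965_cancel_index_zero_of_facts` with the discharged Thm. 4.8
`Cobordism.Milnor1965_finalRearrangement_holds` and local structure at index `1`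
`Cobordism.Milnor1965_localStructure_index_one_holds`) and the cancellation step at `n = 1`
(`exists_isMorseAdapted_ncard_criticalSetOfIndex_zero_add_one_eq_of_firstCancellation`); with the
Morse equality (`morseEuler_of_isMorseAdapted_holds`) the assembly
`diffeomorph_closedBall_of_genus_zero_of_facts` (`SliceGenusDiscMorse.lean`) applies.
[cite: HirschDT1976, Ch. 9 §3, Thm. 3.7] [cite: MilnorHCobordism1965, proof of Thm. 5.4, Assertion 6 (PDF pp. 30–32); Thm. 8.1 Index 0 (PDF p. 54)] -/
theorem diffeomorph_closedBall_of_genus_zero_of_modelChart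
    (hE : Cobordism.Milnor1965_cancellation_modelChart.{0}) :
    diffeomorph_closedBall_of_genus_zero :=
  have h54 : Cobordism.Milnor1965_firstCancellation_slab.{0} :=
    Cobordism.Milnor1965_firstCancellation_slab_of_modelChart hE
  have h81 : Cobordism.Milnor1965_cancel_index_zero.{0} :=
    Cobordism.Milnor1965_cancel_index_zero_of_facts Cobordism.Milnor1965_finalRearrangement_holds
      h54 Cobordism.Milnor1965_localStructure_index_one_holds
  have hK : exists_isMorseAdapted_ncard_criticalSetOfIndex_zero_add_one_eq.{0} 1 :=
    exists_isMorseAdapted_ncard_criticalSetOfIndex_zero_add_one_eq_of_firstCancellation 1 h54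
  diffeomorph_closedBall_of_genus_zero_of_facts h81 hK morseEuler_of_isMorseAdapted_holds

namespace Knot

/-! ### The fact from its open leaves -/

/-- **"… and hence is the trivial knot" from its two open leaves**: the named fact
`Knot.isUnknot_of_hasSeifertSurfaceOfGenus_zero` (`SeifertGenusZero.lean`; Cromwell (2004), Ch. 5,
p. 103) follows from Milnor's chart `ḡ` (`Cobordism.Milnor1965_cancellation_modelChart`, through
`diffeomorph_closedBall_of_genus_zero_of_modelChart`) and the disc theorem in `𝕊 3`
(`exists_ambientIsotopy_of_smoothDisc_sphereThree`; Hirsch (1976), Ch. 8, Thm. 3.1, `k = 2`,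
`n = 3`), by `Knot.isUnknot_of_hasSeifertSurfaceOfGenus_zero_of` (`SeifertDiscUnknot.lean`).
[cite: Cromwell2004, Ch. 5 p. 103] [cite: HirschDT1976, Ch. 8 Thm. 3.1] -/
theorem isUnknot_of_hasSeifertSurfaceOfGenus_zero_of_leaves
    (hE : Cobordism.Milnor1965_cancellation_modelChart.{0})
    (h2 : exists_ambientIsotopy_of_smoothDisc_sphereThree) :
    isUnknot_of_hasSeifertSurfaceOfGenus_zero :=
  isUnknot_of_hasSeifertSurfaceOfGenus_zero_of (diffeomorph_closedBall_of_genus_zero_of_modelChart hE) h2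

/-- **`Knot.genus_eq_zero_iff_isUnknot` from the four leaves still open below it in the tree**:
the circle-map fact (`hθ`), the Betti-number parity (`hpar`), Milnor's chart `ḡ` (`hE`) and the
disc theorem in `𝕊 3` (`h2`), by `genus_eq_zero_iff_isUnknot_of` (`SeifertGenusZero.lean`) with
Seifert's theorem from `hθ` and `hpar` (`exists_hasSeifertSurfaceOfGenus_of_facts`,
`SeifertSurfaceOrientation.lean`, Juhász 2023, Prop. 4.10, with Sard's theorem discharged:
`Literature.Analysis.Calculus.sard_holds`) and
`isUnknot_of_hasSeifertSurfaceOfGenus_zero_of_leaves`.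
The discharge `genus_eq_zero_iff_isUnknot_holds` is this theorem fed with the four `_holds`.
Cromwell (2004), Ch. 5, p. 103 and Thm. 5.1.1; Rolfsen (1976), §5.A; the fact carries the cite
Papakyriakopoulos (1957).  [cite: Cromwell2004, Ch. 5 p. 103 and Thm. 5.1.1] [cite: Papakyriakopoulos1957] -/
theorem genus_eq_zero_iff_isUnknot_of_leaves
    (hθ : exists_circleMap_eq_angle_of_hasFraming_zero)
    (hpar : even_finrank_singularHomology_one_of_boundary_circle)
    (hE : Cobordism.Milnor1965_cancellation_modelChart.{0})
    (h2 : exists_ambientIsotopy_of_smoothDisc_sphereThree) : genus_eq_zero_iff_isUnknot :=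
  genus_eq_zero_iff_isUnknot_of
    (exists_hasSeifertSurfaceOfGenus_of_facts hθ Literature.Analysis.Calculus.sard_holds hpar)
    (isUnknot_of_hasSeifertSurfaceOfGenus_zero_of_leaves hE h2)

end Knot

/-! ### After the discharge of the disc theorem in `𝕊 3` (`SeifertDiscUnknotProofs.lean`) -/

namespace Knot

/-- **"A knot bounding a disc is the trivial knot" from Milnor's chart `ḡ` alone**: the named
fact `Knot.isUnknot_of_hasSeifertSurfaceOfGenus_zero` (`SeifertGenusZero.lean`; Cromwell (2004),
Ch. 5, p. 103) follows from the single Morse-theoretic leaf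
`Cobordism.Milnor1965_cancellation_modelChart` (Milnor 1965, proof of Thm. 5.4, Assertion 6), by
`isUnknot_of_hasSeifertSurfaceOfGenus_zero_of_leaves` with the disc theorem in `𝕊 3` discharged
(`exists_ambientIsotopy_of_smoothDisc_sphereThree_holds`, `SeifertDiscUnknotProofs.lean`; Hirsch
(1976), Ch. 8, Thm. 3.1). [cite: Cromwell2004, Ch. 5 p. 103]
[cite: MilnorHCobordism1965, proof of Thm. 5.4, Assertion 6 (PDF pp. 30–32)] -/
theorem isUnknot_of_hasSeifertSurfaceOfGenus_zero_of_modelChart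
    (hE : Cobordism.Milnor1965_cancellation_modelChart.{0}) :
    isUnknot_of_hasSeifertSurfaceOfGenus_zero :=
  isUnknot_of_hasSeifertSurfaceOfGenus_zero_of_leaves hE
    exists_ambientIsotopy_of_smoothDisc_sphereThree_holds

/-- **`Knot.genus_eq_zero_iff_isUnknot` from the three leaves still open below it**: the
circle-map fact `Knot.exists_circleMap_eq_angle_of_hasFraming_zero` (`hθ`) and the Betti-number
parity `even_finrank_singularHomology_one_of_boundary_circle` (`hpar`) under Seifert's theorem, and
Milnor's chart `Cobordism.Milnor1965_cancellation_modelChart` (`hE`) under the classification of the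
disc — by `genus_eq_zero_iff_isUnknot_of_leaves` with the disc theorem in `𝕊 3` discharged
(`exists_ambientIsotopy_of_smoothDisc_sphereThree_holds`).  The discharge
`genus_eq_zero_iff_isUnknot_holds` is this theorem fed with the three `_holds`, once they exist.
Cromwell (2004), Ch. 5, p. 103 and Thm. 5.1.1. [cite: Cromwell2004, Ch. 5 p. 103 and Thm. 5.1.1]
[cite: Papakyriakopoulos1957] -/
theorem genus_eq_zero_iff_isUnknot_of_leaves'
    (hθ : exists_circleMap_eq_angle_of_hasFraming_zero)
    (hpar : even_finrank_singularHomology_one_of_boundary_circle)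
    (hE : Cobordism.Milnor1965_cancellation_modelChart.{0}) : genus_eq_zero_iff_isUnknot :=
  genus_eq_zero_iff_isUnknot_of_leaves hθ hpar hE exists_ambientIsotopy_of_smoothDisc_sphereThree_holds

end Knot

section SPC4

variable [SphereEmbedding.SmoothnessFacts] in
/-- **Property R from Gabai's Corollary 8.3 and Milnor's chart `ḡ`** (proved reduction of
`isUnknot_of_isIntegralSurgery_zero`, `spc4.S25`: if `S² × S¹` is `0`-surgery on `K ⊆ S³` then `K`
is the unknot; Gabai 1987, Remark 8.5), sharpening
`isUnknot_of_isIntegralSurgery_zero_of_gabai_of_hirsch` (`SeifertDiscUnknot.lean`) by the discharge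
of the disc theorem: the only hypotheses left are Gabai's Corollary 8.3 (genus clause,
`Knot.hasSeifertSurfaceOfGenus_le_of_isIntegralSurgery_zero`) and the Morse-theoretic leaf
`Cobordism.Milnor1965_cancellation_modelChart`, through
`isUnknot_of_isIntegralSurgery_zero_of_gabai_of_disc` (`SeifertGenusZero.lean`) and
`Knot.isUnknot_of_hasSeifertSurfaceOfGenus_zero_of_modelChart`.
[cite: GabaiJDG1987, Cor. 8.3 and Remark 8.5] -/
theorem isUnknot_of_isIntegralSurgery_zero_of_gabai_of_modelChart
    (h83 : Knot.hasSeifertSurfaceOfGenus_le_of_isIntegralSurgery_zero.{0})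
    (hE : Cobordism.Milnor1965_cancellation_modelChart.{0}) : isUnknot_of_isIntegralSurgery_zero :=
  isUnknot_of_isIntegralSurgery_zero_of_gabai_of_disc h83
    (Knot.isUnknot_of_hasSeifertSurfaceOfGenus_zero_of_modelChart hE)

end SPC4

/-! ### The discharges — every leaf below the fact has landed

Seifert's theorem is `Knot.exists_hasSeifertSurfaceOfGenus_holds` (`SliceGenusSeifertProofs.lean`,
from `Knot.exists_circleMap_eq_angle_of_hasFraming_zero_holds`, `Literature.Analysis.Calculus.sard_holds`
and `even_finrank_singularHomology_one_of_boundary_circle_holds`), and Milnor's chart `ḡ` is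
`Cobordism.Milnor1965_cancellation_modelChart_holds` (`HCobordismTheoremProofs.lean`, from
`Cobordism.Milnor1965_cancellation_levelDeformation_holds`).  The reductions of this file and of
`SeifertGenusZero.lean` then close the three named facts below. -/

/-- **The classification of the disc, discharged** (named fact
`Literature.Topology.FourManifolds.diffeomorph_closedBall_of_genus_zero` of `SliceGenusDisc.lean`;
Hirsch, *Differential Topology* (1976), Ch. 9 §3, Thm. 3.7 with `k = 1`, `p = 0`: a compact
connected orientable smooth surface with one boundary circle and `rank H₁ = 0` is diffeomorphic to
the disc `𝔻²`): `diffeomorph_closedBall_of_genus_zero_of_modelChart` fed with Milnor's chart `ḡ`,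
now the theorem `Cobordism.Milnor1965_cancellation_modelChart_holds` (Milnor 1965, proof of
Thm. 5.4, Assertion 6) — i.e. the Morse-theoretic proof: Thm. 5.4 on a slab, Thm. 8.1 Index 0,
the cancellation step at `n = 1` and the Morse equality.
[cite: HirschDT1976, Ch. 9 §3, Thm. 3.7] [cite: MilnorHCobordism1965, proof of Thm. 5.4, Assertion 6 (PDF pp. 30–32); Thm. 8.1 Index 0 (PDF p. 54)] -/
theorem diffeomorph_closedBall_of_genus_zero_holds : diffeomorph_closedBall_of_genus_zero :=
  diffeomorph_closedBall_of_genus_zero_of_modelChart Cobordism.Milnor1965_cancellation_modelChart_holds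

namespace Knot

/-- **"Any knot spanned by a disc is the trivial knot", discharged** (named fact
`Literature.Topology.FourManifolds.Knot.isUnknot_of_hasSeifertSurfaceOfGenus_zero` of
`SeifertGenusZero.lean`; Cromwell, *Knots and Links* (2004), Ch. 5, p. 103): by
`isUnknot_of_hasSeifertSurfaceOfGenus_zero_of_modelChart` — the classification of the disc
(`diffeomorph_closedBall_of_genus_zero_of_modelChart`) and the disc theorem in `𝕊 3`
(`exists_ambientIsotopy_of_smoothDisc_sphereThree_holds`; Hirsch (1976), Ch. 8, Thm. 3.1, `k = 2`,
`n = 3`) — fed with `Cobordism.Milnor1965_cancellation_modelChart_holds`.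
[cite: Cromwell2004, Ch. 5 p. 103] [cite: HirschDT1976, Ch. 8 Thm. 3.1; Ch. 9 §3 Thm. 3.7] -/
theorem isUnknot_of_hasSeifertSurfaceOfGenus_zero_holds : isUnknot_of_hasSeifertSurfaceOfGenus_zero :=
  isUnknot_of_hasSeifertSurfaceOfGenus_zero_of_modelChart
    Cobordism.Milnor1965_cancellation_modelChart_holds

/-- **A knot has genus `0` iff it is the unknot — discharge of the named fact
`Literature.Topology.FourManifolds.Knot.genus_eq_zero_iff_isUnknot`** (`SliceGenus.lean`; Cromwell,
*Knots and Links* (2004), Ch. 5, p. 103: *"Any knot with genus zero is spanned by a disc and hence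
is the trivial knot"*, the genus being well defined by Thm. 5.1.1 (every knot bounds a Seifert
surface); Rolfsen (1976), §4.B, §5.A; the fact carries the cite Papakyriakopoulos (1957), whose
Dehn's lemma gives the stronger `π₁`-characterisation).  Proof: the reduction
`genus_eq_zero_iff_isUnknot_of` (`SeifertGenusZero.lean`: `→` needs Seifert's theorem because
`Knot.genus` is an `sInf` with junk value `0`, then "a knot bounding a disc is trivial"; `←` is
`IsUnknot.genus_eq_zero`, the hemispherical disc) fed with Seifert's theorem
`exists_hasSeifertSurfaceOfGenus_holds` (`SliceGenusSeifertProofs.lean`; Juhász 2023, Prop. 4.10)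
and `isUnknot_of_hasSeifertSurfaceOfGenus_zero_holds` above.  Equivalently
(`genus_eq_zero_iff_isUnknot_of_leaves'`): the circle-map fact, the Betti-number parity and
Milnor's chart `ḡ`, all three now theorems of the tree.
[cite: Cromwell2004, Ch. 5 p. 103 and Thm. 5.1.1] [cite: Papakyriakopoulos1957] -/
theorem genus_eq_zero_iff_isUnknot_holds : genus_eq_zero_iff_isUnknot :=
  genus_eq_zero_iff_isUnknot_of exists_hasSeifertSurfaceOfGenus_holds
    isUnknot_of_hasSeifertSurfaceOfGenus_zero_holds

/-- **A knot is the unknot iff it bounds a smoothly embedded disc in `𝕊 3`**, unconditionally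
(`isUnknot_iff_hasSeifertSurfaceOfGenus_zero_of` fed with
`isUnknot_of_hasSeifertSurfaceOfGenus_zero_holds`).  Cromwell (2004), Ch. 5, p. 103.
[cite: Cromwell2004, Ch. 5 p. 103] -/
theorem isUnknot_iff_hasSeifertSurfaceOfGenus_zero [SphereEmbedding.SmoothnessFacts] (K : Knot) :
    K.IsUnknot ↔ K.HasSeifertSurfaceOfGenus 0 :=
  isUnknot_iff_hasSeifertSurfaceOfGenus_zero_of isUnknot_of_hasSeifertSurfaceOfGenus_zero_holds K

/-- **`g(K) = 0 ↔ K` is the unknot**, the named fact `Knot.genus_eq_zero_iff_isUnknot` in applied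
form (`genus_eq_zero_iff_isUnknot_holds` at a knot `K`).  Cromwell (2004), Ch. 5, p. 103.
[cite: Cromwell2004, Ch. 5 p. 103] -/
theorem genus_eq_zero_iff_isUnknot' [SphereEmbedding.SmoothnessFacts] (K : Knot) :
    K.genus = 0 ↔ K.IsUnknot :=
  genus_eq_zero_iff_isUnknot_holds K

/-- **A knot is non-trivial iff its genus is positive** (contrapositive form of
`Knot.genus_eq_zero_iff_isUnknot`; Cromwell (2004), Ch. 5, p. 103: the genus detects the unknot).
[cite: Cromwell2004, Ch. 5 p. 103] -/
theorem genus_pos_iff_not_isUnknot [SphereEmbedding.SmoothnessFacts] (K : Knot) :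
    0 < K.genus ↔ ¬ K.IsUnknot :=
  Nat.pos_iff_ne_zero.trans (genus_eq_zero_iff_isUnknot_holds K).not

end Knot

section SPC4

variable [SphereEmbedding.SmoothnessFacts] in
/-- **Property R from Gabai's Corollary 8.3 alone** (proved reduction of
`isUnknot_of_isIntegralSurgery_zero`, `spc4.S25`: if `S² × S¹` is `0`-surgery on `K ⊆ S³` then
`K` is the unknot — Gabai 1987, Remark 8.5, p. 526): the only hypothesis left is the genus clause
of Gabai's Corollary 8.3 (`Knot.hasSeifertSurfaceOfGenus_le_of_isIntegralSurgery_zero`: `K` bounds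
a Seifert surface of genus at most that of any nonseparating closed surface in the `0`-surgery),
through `isUnknot_of_isIntegralSurgery_zero_of_gabai_of_disc` (`SeifertGenusZero.lean`) with "a knot
bounding a disc is trivial" discharged (`Knot.isUnknot_of_hasSeifertSurfaceOfGenus_zero_holds`).
This sharpens `isUnknot_of_isIntegralSurgery_zero_of_gabai` (`SurgeryGluckPropertyR.lean`) and
`isUnknot_of_isIntegralSurgery_zero_of_gabai_of_modelChart` above.
[cite: GabaiJDG1987, Cor. 8.3 and Remark 8.5] -/
theorem isUnknot_of_isIntegralSurgery_zero_of_gabai83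
    (h83 : Knot.hasSeifertSurfaceOfGenus_le_of_isIntegralSurgery_zero.{0}) :
    isUnknot_of_isIntegralSurgery_zero :=
  isUnknot_of_isIntegralSurgery_zero_of_gabai_of_disc h83
    Knot.isUnknot_of_hasSeifertSurfaceOfGenus_zero_holds

end SPC4

end Literature.Topology.FourManifolds
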